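import Summits.CriticalPhenomena.SAWScalingLimit.Theses.SAWRenewalTightness
import Summits.CriticalPhenomena.SAWScalingLimit.Theorems.SAWRenewalTightnessShellCrossingBoundConfinementRatio
import Summits.CriticalPhenomena.SAWScalingLimit.Theorems.SAWRenewalTightnessShellCrossingBoundSocketTransfer
import Literature.Probability.RandomPlanarGeometry.SAWRestrictionCovariance
import HarnessLib

/-!
# `EventualTight`, line `Sketch` (v5), stub E `stub_confinementPositivity`: monotonicity of
# confinement positivity in the nested pair (`confinementRatio_mono`)

Crux item `stmt-CriticalPhenomena-1372` (`SAWRenewalTightness.EventualTight`), line `Sketch`,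
registration v5, registered helper `confinementRatio_mono` for the OPEN stub E
`stub_confinementPositivity` (restriction positivity of the critical `ℤ²` self-avoiding walk:
for nested Dobrushin domains `D' ⊆ D` with common sockets, the critical SAW of `D_δ` from `a_δ`
to `b_δ` is, with probability `≥ c > 0` uniformly in small `δ`, the support of a walk of `D'_δ`;
equivalently `liminf_δ Z_{D'}/Z_D > 0`, `Theorems.confinementPositivity_iff_partitionRatio`).

This file does NOT prove E.  It records the first provable move towards it, the reduction of E
to standard pairs by MONOTONICITY of the confinement probability in the nested pair: for
Dobrushin domains `D₁ ⊆ D₂ ⊆ D₃ ⊆ D₄`, a uniform lower bound on `P_{D₄}[γ is a D₁_δ-walk]`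
is a uniform lower bound on `P_{D₃}[γ is a D₂_δ-walk]` (same constant, smaller mesh threshold).

Proof.  For `δ` below the three nesting thresholds of
`JordanDomain.exists_forall_meshDomain_subset` every `Dᵢ_δ`-walk is, with the same support, a
`Dⱼ_δ`-walk for `i ≤ j` (`exists_domainSAW_of_meshDomain_subset`).  Then

* the event is monotone in the INNER domain: a `D₃`-walk whose support is that of a `D₁`-walk
  is one whose support is that of a `D₂`-walk (`ConfinementMono.setOf_exists_support_eq_mono`);
* the law of the event is antitone in the OUTER domain: by the exact restriction identity of
  the critical SAW law (`SAW.law_setOf_exists_support_eq_eq`, Lawler–Schramm–Werner's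
  restriction property on the lattice) `P_{D₄}[γ is a D₁_δ-walk] = Z₄⁻¹ Z₁` and
  `P_{D₃}[γ is a D₁_δ-walk] = Z₃⁻¹ Z₁`, and `Z₃ ≤ Z₄` (`SAW.weight_univ_le_weight_univ`), all
  junk cases included (`ConfinementMono.law_setOf_exists_support_eq_anti`).

Folklore lattice bookkeeping; no new named fact.  Mathlib anchors: `ENNReal.inv_le_inv'`,
`mul_le_mul'`, `MeasureTheory.measure_mono`.  H21 anchors:
`JordanDomain.exists_forall_meshDomain_subset`, `exists_domainSAW_of_meshDomain_subset`
(`…ShellCrossingBoundSocketTransfer.lean`, `…SocketNesting.lean`),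
`SAW.law_setOf_exists_support_eq_eq`, `SAW.weight_univ_le_weight_univ`
(`Literature/…/SAWRestrictionCovariance.lean`).
-/

noncomputable section

open MeasureTheory Set Metric Filter Topology
open scoped unitInterval ENNReal
open Literature.Probability.RandomPlanarGeometry Literature.Probability.LatticeModels

namespace Summit.CriticalPhenomena.SAWScalingLimit.Theorems

/-! ### The two lattice monotonicities at a fixed mesh -/

section Lattice

variable {Ω₁ Ω₂ Ω₃ Ω₄ : Set ℂ} {δ : ℝ} {u v : Site 2}

/-- **Nesting composes**: if every `Ω₁_δ`-walk is (with the same support) an `Ω₂_δ`-walk and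
every `Ω₂_δ`-walk is an `Ω₃_δ`-walk, every `Ω₁_δ`-walk is an `Ω₃_δ`-walk. [folklore] -/
theorem ConfinementMono.nesting_trans
    (h₁₂ : ∀ γ' : SAW.DomainSAW Ω₁ δ u v, ∃ γ : SAW.DomainSAW Ω₂ δ u v,
      γ.walk.support = γ'.walk.support)
    (h₂₃ : ∀ γ' : SAW.DomainSAW Ω₂ δ u v, ∃ γ : SAW.DomainSAW Ω₃ δ u v,
      γ.walk.support = γ'.walk.support) :
    ∀ γ' : SAW.DomainSAW Ω₁ δ u v, ∃ γ : SAW.DomainSAW Ω₃ δ u v,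
      γ.walk.support = γ'.walk.support := by
  intro γ'
  obtain ⟨γ₂, h₂⟩ := h₁₂ γ'
  obtain ⟨γ₃, h₃⟩ := h₂₃ γ₂
  exact ⟨γ₃, h₃.trans h₂⟩

/-- **The confinement event is monotone in the inner domain**: if every `Ω₁_δ`-walk is (with
the same support) an `Ω₂_δ`-walk, an `Ω₃_δ`-walk whose support is that of an `Ω₁_δ`-walk has
the support of an `Ω₂_δ`-walk. [folklore] -/
theorem ConfinementMono.setOf_exists_support_eq_mono
    (h₁₂ : ∀ γ' : SAW.DomainSAW Ω₁ δ u v, ∃ γ : SAW.DomainSAW Ω₂ δ u v,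
      γ.walk.support = γ'.walk.support) :
    {γ : SAW.DomainSAW Ω₃ δ u v | ∃ γ' : SAW.DomainSAW Ω₁ δ u v,
        γ'.walk.support = γ.walk.support} ⊆
      {γ | ∃ γ' : SAW.DomainSAW Ω₂ δ u v, γ'.walk.support = γ.walk.support} := by
  rintro γ ⟨γ', h'⟩
  obtain ⟨γ₂, h₂⟩ := h₁₂ γ'
  exact ⟨γ₂, h₂.trans h'⟩

/-- **The confinement probability is antitone in the outer domain** (all junk cases
included): under the nestings `Ω₁_δ → Ω₃_δ → Ω₄_δ` (every walk of the smaller discrete domain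
is, with the same support, a walk of the bigger one),
`P_{Ω₄}[γ is an Ω₁_δ-walk] ≤ P_{Ω₃}[γ is an Ω₁_δ-walk]`, because by the exact restriction
identity of the critical SAW law the two sides are `Z₄⁻¹ Z₁` and `Z₃⁻¹ Z₁` with `Z₃ ≤ Z₄`.
[folklore] -/
theorem ConfinementMono.law_setOf_exists_support_eq_anti
    (h₁₃ : ∀ γ' : SAW.DomainSAW Ω₁ δ u v, ∃ γ : SAW.DomainSAW Ω₃ δ u v,
      γ.walk.support = γ'.walk.support)
    (h₃₄ : ∀ γ' : SAW.DomainSAW Ω₃ δ u v, ∃ γ : SAW.DomainSAW Ω₄ δ u v,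
      γ.walk.support = γ'.walk.support) :
    SAW.law Ω₄ δ u v {γ | ∃ γ' : SAW.DomainSAW Ω₁ δ u v,
        γ'.walk.support = γ.walk.support} ≤
      SAW.law Ω₃ δ u v {γ | ∃ γ' : SAW.DomainSAW Ω₁ δ u v,
        γ'.walk.support = γ.walk.support} := by
  rw [SAW.law_setOf_exists_support_eq_eq (ConfinementMono.nesting_trans h₁₃ h₃₄),
    SAW.law_setOf_exists_support_eq_eq h₁₃]
  exact mul_le_mul' (ENNReal.inv_le_inv' (SAW.weight_univ_le_weight_univ h₃₄)) le_rfl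

end Lattice

/-! ### The registered helper -/

/-- **Helper `confinementRatio_mono` for STUB E (monotonicity of confinement positivity in the
nested pair).** For Dobrushin domains `D₁ ⊆ D₂ ⊆ D₃ ⊆ D₄` and lattice endpoints `a_δ, b_δ`, a
lower bound `P_{D₄}[γ is a D₁_δ-walk] ≥ c > 0` for `δ ∈ (0, δ₀]` gives
`P_{D₃}[γ is a D₂_δ-walk] ≥ c` for `δ ∈ (0, δ₀']`, `δ₀' = min δ₀ (nesting thresholds)`: below
the nesting thresholds of `JordanDomain.exists_forall_meshDomain_subset` the discrete domains
are nested (`exists_domainSAW_of_meshDomain_subset`), the event grows with the inner domain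
(`ConfinementMono.setOf_exists_support_eq_mono`) and its probability decreases with the outer
domain (`ConfinementMono.law_setOf_exists_support_eq_anti`, the exact restriction identity
`P_Ω[γ is an Ω'_δ-walk] = Z_Ω⁻¹ Z_{Ω'}` with `Z` monotone under nesting).  The endpoint
approximation hypothesis is not used. [folklore] -/
theorem confinementRatio_mono :
    ∀ (D₁ D₂ D₃ D₄ : DobrushinDomain) (a b : ℝ → Site 2), D₁.carrier ⊆ D₂.carrier →
      D₂.carrier ⊆ D₃.carrier → D₃.carrier ⊆ D₄.carrier → SAW.IsEndpointApprox D₁ a b →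
      (∃ c δ₀ : ℝ, 0 < c ∧ 0 < δ₀ ∧ ∀ δ ∈ Set.Ioc (0 : ℝ) δ₀,
        ENNReal.ofReal c ≤ SAW.law D₄.carrier δ (a δ) (b δ)
          {γ | ∃ γ' : SAW.DomainSAW D₁.carrier δ (a δ) (b δ),
            γ'.walk.support = γ.walk.support}) →
      ∃ c δ₀ : ℝ, 0 < c ∧ 0 < δ₀ ∧ ∀ δ ∈ Set.Ioc (0 : ℝ) δ₀,
        ENNReal.ofReal c ≤ SAW.law D₃.carrier δ (a δ) (b δ)
          {γ | ∃ γ' : SAW.DomainSAW D₂.carrier δ (a δ) (b δ),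
            γ'.walk.support = γ.walk.support} := by
  intro D₁ D₂ D₃ D₄ a b h₁₂ h₂₃ h₃₄ _ hE
  obtain ⟨c, δ₀, hc, hδ₀, hconf⟩ := hE
  -- the three nesting thresholds of the discrete domains
  obtain ⟨δa, hδa, hna⟩ :=
    D₁.toJordanDomain.exists_forall_meshDomain_subset D₂.toJordanDomain h₁₂
  obtain ⟨δb, hδb, hnb⟩ :=
    D₂.toJordanDomain.exists_forall_meshDomain_subset D₃.toJordanDomain h₂₃
  obtain ⟨δc, hδc, hnc⟩ :=
    D₃.toJordanDomain.exists_forall_meshDomain_subset D₄.toJordanDomain h₃₄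
  refine ⟨c, min δ₀ (min δa (min δb δc)), hc, lt_min hδ₀ (lt_min hδa (lt_min hδb hδc)),
    fun δ hδ => ?_⟩
  have hδ0 : δ ∈ Set.Ioc (0 : ℝ) δ₀ := ⟨hδ.1, hδ.2.trans (min_le_left _ _)⟩
  have hδa' : δ ≤ δa := hδ.2.trans ((min_le_right _ _).trans (min_le_left _ _))
  have hδb' : δ ≤ δb :=
    hδ.2.trans ((min_le_right _ _).trans ((min_le_right _ _).trans (min_le_left _ _)))
  have hδc' : δ ≤ δc :=
    hδ.2.trans ((min_le_right _ _).trans ((min_le_right _ _).trans (min_le_right _ _)))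
  -- nesting of the walks at mesh `δ`
  have hN₁₂ : ∀ γ' : SAW.DomainSAW D₁.carrier δ (a δ) (b δ),
      ∃ γ : SAW.DomainSAW D₂.carrier δ (a δ) (b δ), γ.walk.support = γ'.walk.support :=
    fun γ' => exists_domainSAW_of_meshDomain_subset h₁₂ (hna δ hδ.1 hδa') γ'
  have hN₂₃ : ∀ γ' : SAW.DomainSAW D₂.carrier δ (a δ) (b δ),
      ∃ γ : SAW.DomainSAW D₃.carrier δ (a δ) (b δ), γ.walk.support = γ'.walk.support :=
    fun γ' => exists_domainSAW_of_meshDomain_subset h₂₃ (hnb δ hδ.1 hδb') γ'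
  have hN₃₄ : ∀ γ' : SAW.DomainSAW D₃.carrier δ (a δ) (b δ),
      ∃ γ : SAW.DomainSAW D₄.carrier δ (a δ) (b δ), γ.walk.support = γ'.walk.support :=
    fun γ' => exists_domainSAW_of_meshDomain_subset h₃₄ (hnc δ hδ.1 hδc') γ'
  calc ENNReal.ofReal c
      ≤ SAW.law D₄.carrier δ (a δ) (b δ)
          {γ | ∃ γ' : SAW.DomainSAW D₁.carrier δ (a δ) (b δ),
            γ'.walk.support = γ.walk.support} := hconf δ hδ0
    _ ≤ SAW.law D₃.carrier δ (a δ) (b δ)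
          {γ | ∃ γ' : SAW.DomainSAW D₁.carrier δ (a δ) (b δ),
            γ'.walk.support = γ.walk.support} :=
        ConfinementMono.law_setOf_exists_support_eq_anti
          (ConfinementMono.nesting_trans hN₁₂ hN₂₃) hN₃₄
    _ ≤ SAW.law D₃.carrier δ (a δ) (b δ)
          {γ | ∃ γ' : SAW.DomainSAW D₂.carrier δ (a δ) (b δ),
            γ'.walk.support = γ.walk.support} :=
        measure_mono (ConfinementMono.setOf_exists_support_eq_mono hN₁₂)

end Summit.CriticalPhenomena.SAWScalingLimit.Theorems

end
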